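import Summits.SmoothPoincare4.SmoothPoincare4.Theorems.CappellShanesonSpheresStandard
import Literature.Topology.FourManifolds.CappellShanesonHomotopySphereHolds
import HarnessLib

/-!
# Consequences of / reductions to the Cappell–Shaneson conjecture (canonical statement)

Conjecture/notion split (coordinator ruling 2026-08-15; ledger item
`split:Literature.Topology.FourManifolds.CappellShaneson#CappellShanesonSpheresStandard`): the open
conjecture «every Cappell–Shaneson homotopy 4-sphere is diffeomorphic to `S⁴`» is CANONICAL at
`Summit.SmoothPoincare4.SmoothPoincare4.CappellShanesonSpheresStandard` (conjecture leaf
`Summits/SmoothPoincare4/SmoothPoincare4/Theorems/CappellShanesonSpheresStandard.lean`, importable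
from `Literature/`), while the VOCABULARY (`IsCappellShanesonSphere`, the family `Aₘ`, the named
facts of Cappell–Shaneson 1976 / Akbulut 2010 / Gompf 2010 / Kim–Yamada 2023) stays in
`Literature/Topology/FourManifolds/CappellShaneson.lean`. This file carries the declarations ABOUT
the conjecture — the formal content of Kim–Yamada's sentence that it «is a special case of the
smooth 4-dimensional Poincaré conjecture» — stated for the CANONICAL conjecture, so that the tagged
duplicate `Literature.Topology.FourManifolds.CappellShanesonSpheresStandard` and the theorems about
it (`CappellShanesonSpheresStandard.of_nonemptyDiffeomorphSphere_four`,
`not_forall_nonemptyDiffeomorphSphere_four_of_not_cappellShanesonSpheresStandard` in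
`CappellShaneson.lean`; `CappellShanesonSpheresStandard.of_smoothPoincareFour`,
`not_smoothPoincareFour_of_not_cappellShanesonSpheresStandard` in
`CappellShanesonHomotopySphereHolds.lean`) can be retired once their users
(`Literature/Barriers/SmoothPoincare4/LADDER.lean`) point here. The two definitions are
syntactically identical, so `Iff.rfl` relates them (`cappellShanesonSpheresStandard_iff_literature`,
to be deleted together with the duplicate).

Sources: M. H. Kim, S. Yamada, Kyungpook Math. J. 63 (2023) 373–411 = arXiv:1707.03860, §1 («The
following folklore conjecture is a special case of the smooth 4-dimensional Poincaré conjecture …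
Conjecture 1. Every Cappell–Shaneson homotopy 4-sphere is diffeomorphic to `S⁴`»); R. Gompf,
Algebr. Geom. Topol. 10 (2010), §1; S. E. Cappell, J. L. Shaneson, Ann. of Math. 104 (1976), §2
(the spheres are homotopy 4-spheres: tree theorem
`nonempty_homotopyEquiv_sphere_four_of_isCappellShanesonSphere_holds`). Everything here is PROVED
(one-line reductions); no named fact, no `sorry`, no instance, no notation.
-/

open scoped Manifold ContDiff

namespace Literature.Topology.FourManifolds

/-- The canonical conjecture (Summits leaf) and the tagged Literature duplicate are the same
proposition, definitionally (both read: every compact Hausdorff second-countable smooth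
4-manifold `X` with `IsCappellShanesonSphere X` is diffeomorphic to `S⁴`). Transitional lemma for
the migration; delete with the duplicate. [cite: KimYamada2023, §1, Conjecture 1] -/
theorem cappellShanesonSpheresStandard_iff_literature :
    Summit.SmoothPoincare4.SmoothPoincare4.CappellShanesonSpheresStandard ↔
      Literature.Topology.FourManifolds.CappellShanesonSpheresStandard :=
  Iff.rfl

/-- **The Cappell–Shaneson conjecture is a special case of SPC4** (canonical statement). If every
Hausdorff, second countable smooth 4-manifold homotopy equivalent to `S⁴` is diffeomorphic to `S⁴`
(Mathlib's `ContinuousMap.HomotopyEquiv.NonemptyDiffeomorphSphere M 4` over all `M : Type` — the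
body of the summit statement `SmoothPoincare4`), then, granted Cappell–Shaneson's theorem that
their spheres are homotopy 4-spheres (hypothesis `hCS`, the named fact
`nonempty_homotopyEquiv_sphere_four_of_isCappellShanesonSphere`), every Cappell–Shaneson sphere is
diffeomorphic to `S⁴`. Kim–Yamada 2023, §1; Gompf 2010, §1. [cite: KimYamada2023, §1] -/
theorem cappellShanesonSpheresStandard_of_nonemptyDiffeomorphSphere_four
    (hSPC4 : ∀ (M : Type) [TopologicalSpace M] [T2Space M] [SecondCountableTopology M],
      ContinuousMap.HomotopyEquiv.NonemptyDiffeomorphSphere M 4)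
    (hCS : ∀ (X : Type) [TopologicalSpace X] [T2Space X] [SecondCountableTopology X]
      [ChartedSpace (EuclideanSpace ℝ (Fin 4)) X] [IsManifold (𝓡 4) ∞ X] [CompactSpace X],
      nonempty_homotopyEquiv_sphere_four_of_isCappellShanesonSphere X) :
    Summit.SmoothPoincare4.SmoothPoincare4.CappellShanesonSpheresStandard := by
  intro X _ _ _ _ _ _ hX
  obtain ⟨e⟩ := hCS X hX
  exact hSPC4 X ‹_› ‹_› e

/-- **An exotic Cappell–Shaneson sphere would refute SPC4** (contrapositive, canonical statement):
granted `hCS`, the failure of the Cappell–Shaneson conjecture negates the smooth 4-dimensional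
Poincaré conjecture in Mathlib's form («the most notable, potential counterexamples of the smooth
4-dimensional Poincaré conjecture», Kim–Yamada 2023, §1). [cite: KimYamada2023, §1] -/
theorem not_forall_nonemptyDiffeomorphSphere_four_of_not_cappellShanesonSpheresStandard'
    (hCS : ∀ (X : Type) [TopologicalSpace X] [T2Space X] [SecondCountableTopology X]
      [ChartedSpace (EuclideanSpace ℝ (Fin 4)) X] [IsManifold (𝓡 4) ∞ X] [CompactSpace X],
      nonempty_homotopyEquiv_sphere_four_of_isCappellShanesonSphere X)
    (h : ¬ Summit.SmoothPoincare4.SmoothPoincare4.CappellShanesonSpheresStandard) :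
    ¬ ∀ (M : Type) [TopologicalSpace M] [T2Space M] [SecondCountableTopology M],
      ContinuousMap.HomotopyEquiv.NonemptyDiffeomorphSphere M 4 :=
  fun hSPC4 => h (cappellShanesonSpheresStandard_of_nonemptyDiffeomorphSphere_four hSPC4 hCS)

/-- **The Cappell–Shaneson conjecture is a special case of SPC4 — unconditionally** (canonical
statement; the homotopy-sphere hypothesis discharged by the tree theorem
`nonempty_homotopyEquiv_sphere_four_of_isCappellShanesonSphere_holds`, Cappell–Shaneson 1976, §2).
Kim–Yamada 2023, §1. [cite: KimYamada2023, §1] -/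
theorem cappellShanesonSpheresStandard_of_smoothPoincareFour
    (hSPC4 : ∀ (M : Type) [TopologicalSpace M] [T2Space M] [SecondCountableTopology M],
      ContinuousMap.HomotopyEquiv.NonemptyDiffeomorphSphere M 4) :
    Summit.SmoothPoincare4.SmoothPoincare4.CappellShanesonSpheresStandard :=
  cappellShanesonSpheresStandard_of_nonemptyDiffeomorphSphere_four hSPC4
    fun X _ _ _ _ _ _ => nonempty_homotopyEquiv_sphere_four_of_isCappellShanesonSphere_holds X

/-- **An exotic Cappell–Shaneson sphere would refute SPC4 — unconditionally** (canonical
statement). Kim–Yamada 2023, §1. [cite: KimYamada2023, §1] -/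
theorem not_smoothPoincareFour_of_not_cappellShanesonSpheresStandard'
    (h : ¬ Summit.SmoothPoincare4.SmoothPoincare4.CappellShanesonSpheresStandard) :
    ¬ ∀ (M : Type) [TopologicalSpace M] [T2Space M] [SecondCountableTopology M],
      ContinuousMap.HomotopyEquiv.NonemptyDiffeomorphSphere M 4 :=
  fun hSPC4 => h (cappellShanesonSpheresStandard_of_smoothPoincareFour hSPC4)

end Literature.Topology.FourManifolds
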